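import Literature.MathematicalPhysics.QuantumFieldTheory.Balaban1983to89.B8Thm2TorusLetters

/-!
# `Balaban1983to89.B8Thm2TorusLettersPer` — [Balaban1985RegularSpaces] Thm 2 on `T_η`: THE v3 LETTER BUNDLE `LettersAtPer` — the [4] letters
# ([Balaban1985BackgroundPropagators] Thms 3.1–3.3) at ONE `P`-periodic background with EVERY LAW QUANTIFIED OVER `P`-PERIODIC ARGUMENTS ONLY
# (lead RULING #4 of sub-row «G-B8-T2S»), and its binders `LettersAllPer`, `LettersPerTau`, `LettersAllPerTau`

statement-level skeleton of published theorems with citation tags; proofs where landed; nothing here is a claim about the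
Yang–Mills mass gap

T. Bałaban, *Spaces of regular gauge field configurations on a lattice and gauge fixing conditions*, Commun. Math. Phys. **99** (1985) 75–102
`[Balaban1985RegularSpaces]` ("B8"): (1.91)–(1.92) p. 91, (1.95)–(1.98) p. 92, (1.101)–(1.103) p. 93, Prop. 5 p. 94, (1.57)–(1.59) p. 86, p. 77 («Ω_j = T_η»,
«we admit the case where some domains Ω_j are equal to T_η»).  T. Bałaban, *Propagators for lattice gauge theories in a background field*, Commun. Math.
Phys. **99** (1985) 389–434 `[Balaban1985BackgroundPropagators]` ("[4]"): Thm 3.1 p. 397, Thm 3.2 p. 398, Thm 3.3 p. 399, (3.19)–(3.27) pp. 393–395 — all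
stated for operators on the TORUS `T_η` (periodic boundary conditions).  STATUS: published, refereed.

CITATION HEADER (lean-in-tree rule).  Cell `lit-balaban`, seat `lit-balaban-t2s-1` (gen 2), sub-row «G-B8-T2S» (R3 `stmt-QuantumFields-19200`, helper),
route P, v3.  WHY THIS FILE.  The landed endpoint `B8Thm2TorusAtOfLetters.thm2TorusAt_specialUnitary_of_letters` (M4) consumes the v2 binder
`B8Thm2TorusLetters.LettersAllP`: the [4] letters at every `P`-PERIODIC background, but with their laws ((E1)–(E16), (U1)–(U3), (B)) quantified over ALL
argument configurations on `ℤᵈ`.  Print's operators live on the torus `T_η` ([4] §3, p. 77 of [B8]): read on `ℤᵈ` (periodic extension through the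
fundamental box) they satisfy the laws AT `P`-PERIODIC ARGUMENTS ONLY — e.g. (E1) `ΔG′x + Q′ᵀ𝔄Q′G′x = x` fails at a non-periodic `x` for the periodised
torus Green's function.  Lead RULING #4 (R-E1) = (α): «v3 `LettersAtP` quantifies (E1) AND all bound laws over P-PERIODIC arguments only; re-thread the
Prop-5 contraction on the closed shift-invariant subspace; v1∕v2 decls stay, v3 append-only».  This file FIXES THE v3 SPELLING the letter-constructing
seats (G-B9-LETTERS) inhabit and the re-threaded servers consume:
* §1 **`LettersAtPer L BG BR B₀′H B₂′ B₀ B₀β cB β len η m α₀ P U₀`** — `B8Thm2TorusLetters.LettersAt` VERBATIM (same data: `ℂ`-linear `Gp`, `lapU`, `Qp`,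
  `QpT`, `Aw`, `Cinv`, `Hp` per truncation; same constants) with EVERY law's argument restricted to `P`-periodic configurations — a site function `f` is
  `P`-periodic iff `f(x + P•eᵢ) = f(x)`; a level-indexed family `μ` (multipliers, averages) iff `μ_j(y + (P∕Lʲ)•eᵢ) = μ_j(y)` for `j ≤ n` (the level-`j`
  lattice of the torus of side `P` has side `P∕Lʲ`; `P ∈ Lᵐℤ`, cf. `B8TorusShiftLandau.QT_torusLam_shiftCfg`: translating the fine lattice by `Lʲw`
  translates level `j` by `w`); a family `X ∈ XSpace` likewise — PLUS the six laws «the letters map periodic arguments to periodic values» (`gp_per`,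
  `qp_per`, `qpT_per`, `aw_per`, `cinv_per`, `hp_per`; automatic for periodised torus operators), which the re-threaded contraction needs to stay in the
  closed shift-invariant subspace.
* §2 **`LettersAllPer … cL η k P G`** (the binder: every truncation `m ≤ k`, every `0 < α₀ ≤ c_L`, every `G`-valued `P`-periodic background of the class),
  **`LettersPerTau τ`**, **`LettersAllPerTau τ`** (the J-SU `τ`-laws, periodic arguments), and the monotonicity `lettersAllPer_anti` in `c_L`.

## HONEST SCOPE
Hypothesis bundles (a `structure` of data + laws and `Type`∕`Prop` binders), ASSERTED FOR NOTHING and inhabited by nothing here; [4] is not proved.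
The v3 servers (the π-converter `LettersAtPer → all-argument bound∕reads∕reality laws`, and the engine copies re-threading the identity laws (E1), (E2),
(E11), (U1), (U2) at periodic arguments) are NOT in this file (design: `lit-balaban-t2s-1/g2/V3-DESIGN.md`).  v1∕v2 (`LettersAt`, `LettersAll`,
`LettersAllP`) untouched.  Count-neutral; N05 ∕ `stub_PV3A` NOT discharged; nothing continuum ∕ ℝ⁴ ∕ OS ∕ mass-gap ∕ Clay — the Yang–Mills mass gap is
NOT proved.  No `sorry`, no `… : Prop` fact, no `instance`, no `notation`.
-/

noncomputable section

open NormedSpace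
open scoped BigOperators

namespace Literature.MathematicalPhysics.QuantumFieldTheory.Balaban1983to89.B8Thm2TorusLettersPer

open B7Prop1Explicit B7Prop2Explicit B7Prop1Local
open B7Eq78Linearization (zdBlocking QprimeIter)
open B8Ineq132 (covDerivFwd InAk)
open B8Eq119TwistedAxial (bgT)
open B8Eq140Level (SideTouches)
open B8Eq138LandauZd (covLap QT IsLandau138W)
open B8Eq1117Concrete (XSpace)
open B8Prop5ContractionKLevel (Bd2)
open B8LambdaSpaceKLevel (wt)
open B8Eq184Proof (cfgExp)
open B8Lemma1NonAbelian (mulCfg)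
open B8Eq146AExpansion (iEta plaqCovDeriv)
open B8Eq143PlaqExpansion (pdiv)
open B7Prop4GeneralLevels (linCovIter)
open B8Eq155JBound (Jcur wsup)
open B8ScaledSupNorm (bondNorm msup)
open B9Eq340HolderZd (hquot AdmPair)
open B8Thm4TorusAt (torusLam)
open B8Thm2TorusMember (torusLamb)

-- `Site` alone could resolve to the torus sites of `Setup.lean`; re-export the `ℤ^d` sites of `B7Prop1Explicit`.
export B7Prop1Explicit (Site)

variable {d : ℕ}

/-! ## §1 The v3 letter bundle at one periodic background: laws at periodic arguments -/

section Bundle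

variable {𝔸 : Type*} [CStarAlgebra 𝔸]

/-- **THE [4]-LETTERS AT ONE `P`-PERIODIC BACKGROUND `U₀` ON THE TORUS, TRUNCATION `m`, REGULARITY `α₀` — LAWS AT `P`-PERIODIC ARGUMENTS (v3).**
DATA as in `B8Thm2TorusLetters.LettersAt` (for every truncation `n`: `Gp n = G′(U₀)`, `lapU n = Δ`, `Qp n = Q′`, `QpT n = Q′ᵀ`, `Aw n = 𝔄`, `Cinv n = C`,
`Hp n = H′`, `ℂ`-linear on the site functions of `ℤᵈ`).  LAWS: (P) the letters map `P`-periodic arguments to `P`-periodic values (site functions: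
`f(x + P•eᵢ) = f(x)`; level families: `μ_j(y + (P∕Lʲ)•eᵢ) = μ_j(y)`, `j ≤ n`; `X ∈ XSpace`: the same at every level index); (E1)–(E16) and (U1)–(U3) of
`LettersAt` VERBATIM with every universally quantified argument (`x`, `f`, `φ`, `μ`, `X`, `Y`) restricted to `P`-periodic ones; (B) the in-edge b9 in
Proposition 3's frame for `P`-periodic `W`, `A′`.  This is what [4] Thms 3.1–3.3 give for Bałaban's operators on `T_η` extended periodically to `ℤᵈ`
(period `P ∈ Lᵐℤ` on the fine lattice).  A hypothesis bundle; nothing asserted.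
[cite: Balaban1985RegularSpaces, (1.91)–(1.92) p.91, (1.95)–(1.98) p.92, (1.101)–(1.103) p.93, (1.57)–(1.59) p.86, Prop. 5 p.94, p.77 («Ω_j = T_η»); Balaban1985BackgroundPropagators, Thm 3.1 p.397, Thm 3.2 p.398, Thm 3.3 p.399, (3.19)–(3.27) pp.393–395] -/
structure LettersAtPer (L : ℕ) (BG BR B₀'H B₂' B₀ B₀β cB β : ℝ) (len : Site d → ℝ) (η : ℝ) (m : ℕ) (α₀ : ℝ) (P : ℤ)
    (U₀ : Site d → Fin d → 𝔸ˣ) where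
  /-- `G′(U₀)` at truncation `n` ((1.95); [4] Thm 3.1). -/
  Gp : ℕ → ((Site d → 𝔸) →ₗ[ℂ] (Site d → 𝔸))
  /-- the covariant Laplacian letter `Δ` at truncation `n` ((1.2)). -/
  lapU : ℕ → ((Site d → 𝔸) →ₗ[ℂ] (Site d → 𝔸))
  /-- `Q′(U₀)` at truncation `n` (all levels `j ≤ n`). -/
  Qp : ℕ → ((Site d → 𝔸) →ₗ[ℂ] (ℕ → Site d → 𝔸))
  /-- `Q′(U₀)ᵀ` at truncation `n`. -/
  QpT : ℕ → ((ℕ → Site d → 𝔸) →ₗ[ℂ] (Site d → 𝔸))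
  /-- the a-weights operator `𝔄` at truncation `n`. -/
  Aw : ℕ → ((ℕ → Site d → 𝔸) →ₗ[ℂ] (ℕ → Site d → 𝔸))
  /-- `C = (Q′G′²Q′ᵀ)⁻¹` at truncation `n` ((1.96)–(1.97); [4] Thm 3.2). -/
  Cinv : ℕ → ((ℕ → Site d → 𝔸) →ₗ[ℂ] (ℕ → Site d → 𝔸))
  /-- `H′(U₀)` at truncation `n` ((1.91)–(1.92)). -/
  Hp : (n : ℕ) → (XSpace d n 𝔸 →ₗ[ℂ] (Site d → 𝔸))
  /-- (P1) `G′` maps periodic site functions to periodic site functions. -/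
  gp_per : ∀ n, 1 ≤ n → n ≤ m → ∀ f : Site d → 𝔸, (∀ (z : Site d) (i : Fin d), f (z + P • e i) = f z) →
    (∀ (z : Site d) (i : Fin d), (Gp n f) (z + P • e i) = (Gp n f) z)
  /-- (P2) `Q′` maps periodic site functions to level-periodic families. -/
  qp_per : ∀ n, 1 ≤ n → n ≤ m → ∀ f : Site d → 𝔸, (∀ (z : Site d) (i : Fin d), f (z + P • e i) = f z) →
    (∀ j, j ≤ n → ∀ (y : Site d) (i : Fin d), (Qp n f) j (y + (P / (L : ℤ) ^ j) • e i) = (Qp n f) j y)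
  /-- (P3) `Q′ᵀ` maps level-periodic families to periodic site functions. -/
  qpT_per : ∀ n, 1 ≤ n → n ≤ m → ∀ μ : ℕ → Site d → 𝔸,
    (∀ j, j ≤ n → ∀ (y : Site d) (i : Fin d), μ j (y + (P / (L : ℤ) ^ j) • e i) = μ j y) →
    (∀ (z : Site d) (i : Fin d), (QpT n μ) (z + P • e i) = (QpT n μ) z)
  /-- (P4) `𝔄` maps level-periodic families to level-periodic families. -/
  aw_per : ∀ n, 1 ≤ n → n ≤ m → ∀ μ : ℕ → Site d → 𝔸,
    (∀ j, j ≤ n → ∀ (y : Site d) (i : Fin d), μ j (y + (P / (L : ℤ) ^ j) • e i) = μ j y) →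
    (∀ j, j ≤ n → ∀ (y : Site d) (i : Fin d), (Aw n μ) j (y + (P / (L : ℤ) ^ j) • e i) = (Aw n μ) j y)
  /-- (P5) `C` maps level-periodic families to level-periodic families. -/
  cinv_per : ∀ n, 1 ≤ n → n ≤ m → ∀ μ : ℕ → Site d → 𝔸,
    (∀ j, j ≤ n → ∀ (y : Site d) (i : Fin d), μ j (y + (P / (L : ℤ) ^ j) • e i) = μ j y) →
    (∀ j, j ≤ n → ∀ (y : Site d) (i : Fin d), (Cinv n μ) j (y + (P / (L : ℤ) ^ j) • e i) = (Cinv n μ) j y)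
  /-- (P6) `H′` maps level-periodic families of `XSpace` to periodic site functions. -/
  hp_per : ∀ n, 1 ≤ n → n ≤ m → ∀ X : XSpace d n 𝔸,
    (∀ (p : Fin (n + 1) × Site d) (i : Fin d), X (p.1, p.2 + (P / (L : ℤ) ^ (p.1 : ℕ)) • e i) = X p) →
    (∀ (z : Site d) (i : Fin d), (Hp n X) (z + P • e i) = (Hp n X) z)
  /-- (E1) right-inverse law of `G′`, pointwise, at periodic arguments ([4] Thm 3.1 on `T_η`). -/
  gp_right : ∀ n, 1 ≤ n → n ≤ m → ∀ x : Site d → 𝔸, (∀ (z : Site d) (i : Fin d), x (z + P • e i) = x z) → ∀ y ∈ (Set.univ : Set (Site d)),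
    (lapU n (Gp n x) + QpT n (Aw n (Qp n (Gp n x)))) y = x y
  /-- (E2) the law of `C` on the range of `Q′`, at periodic arguments ([4] (3.25)). -/
  cinv_range : ∀ n, 1 ≤ n → n ≤ m → ∀ f : Site d → 𝔸, (∀ (z : Site d) (i : Fin d), f (z + P • e i) = f z) →
    Qp n (Gp n (Gp n (QpT n (Cinv n (Qp n f))))) = Qp n f
  /-- (E3) `Δ` IS the covariant Laplacian, at periodic arguments. -/
  lapU_reads : ∀ n, 1 ≤ n → n ≤ m → ∀ (f : Site d → 𝔸), (∀ (z : Site d) (i : Fin d), f (z + P • e i) = f z) → ∀ x ∈ (Set.univ : Set (Site d)),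
    lapU n f x = covLap η U₀ ((Set.univ : Set (Site d)).indicator f) x
  /-- (E4) `Q′ᵀ` IS `QT` at `(n, torusLam n)`, at level-periodic multipliers. -/
  qpT_reads : ∀ n, 1 ≤ n → n ≤ m → ∀ (μ : ℕ → Site d → 𝔸),
    (∀ j, j ≤ n → ∀ (y : Site d) (i : Fin d), μ j (y + (P / (L : ℤ) ^ j) • e i) = μ j y) → ∀ x ∈ (Set.univ : Set (Site d)),
    QpT n μ x = QT L n (torusLam (d := d) n) U₀ μ x
  /-- (E5) `Q′` IS the iterated average at the tower sites of `torusLam n`, at periodic arguments. -/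
  qp_reads : ∀ n, 1 ≤ n → n ≤ m → ∀ (f : Site d → 𝔸), (∀ (z : Site d) (i : Fin d), f (z + P • e i) = f z) →
    ∀ (j : ℕ), j ≤ n → ∀ y ∈ torusLam (d := d) n j,
    Qp n f j y = QprimeIter (zdBlocking d L) (bgT L U₀) j f y
  /-- (E6) (1.92), sup line for `H′`, at level-periodic families. -/
  hp_sup : ∀ n, 1 ≤ n → n ≤ m → ∀ (X : XSpace d n 𝔸),
    (∀ (p : Fin (n + 1) × Site d) (i : Fin d), X (p.1, p.2 + (P / (L : ℤ) ^ (p.1 : ℕ)) • e i) = X p) → ∀ (x : Site d), ‖Hp n X x‖ ≤ B₀'H * ‖X‖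
  /-- (E7) (1.92), weighted-gradient line for `H′`, at level-periodic families. -/
  hp_grad : ∀ n, 1 ≤ n → n ≤ m → ∀ j, j ≤ n → ∀ (X : XSpace d n 𝔸),
    (∀ (p : Fin (n + 1) × Site d) (i : Fin d), X (p.1, p.2 + (P / (L : ℤ) ^ (p.1 : ℕ)) • e i) = X p) →
    ∀ p ∈ {b : Site d × Fin d | SideTouches (Set.univ : Set (Site d)) b.1 b.2},
      wt L η j * ‖covDerivFwd η U₀ p.2 (Hp n X) p.1‖ ≤ B₀'H * ‖X‖
  /-- (E8) (1.92), `(−2)`-weighted Laplacian line for `H′`, at level-periodic families. -/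
  hp_lap : ∀ n, 1 ≤ n → n ≤ m → ∀ X : XSpace d n 𝔸, (∀ (p : Fin (n + 1) × Site d) (i : Fin d), X (p.1, p.2 + (P / (L : ℤ) ^ (p.1 : ℕ)) • e i) = X p) →
    Bd2 L η n (fun _ => (Set.univ : Set (Site d))) (covLap η U₀ (Hp n X)) (B₂' * ‖X‖)
  /-- (E9) Dirichlet range of `H′` (vacuous at `Ω₀ = ℤᵈ`, kept verbatim), at level-periodic families. -/
  hp_dirichlet : ∀ n, 1 ≤ n → n ≤ m → ∀ (X : XSpace d n 𝔸),
    (∀ (p : Fin (n + 1) × Site d) (i : Fin d), X (p.1, p.2 + (P / (L : ℤ) ^ (p.1 : ℕ)) • e i) = X p) → ∀ (x : Site d), x ∉ (Set.univ : Set (Site d)) → Hp n X x = 0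
  /-- (E10) reality of `H′`, at level-periodic families. -/
  hp_real : ∀ n, 1 ≤ n → n ≤ m → ∀ X Y : XSpace d n 𝔸,
    (∀ (p : Fin (n + 1) × Site d) (i : Fin d), X (p.1, p.2 + (P / (L : ℤ) ^ (p.1 : ℕ)) • e i) = X p) →
    (∀ (p : Fin (n + 1) × Site d) (i : Fin d), Y (p.1, p.2 + (P / (L : ℤ) ^ (p.1 : ℕ)) • e i) = Y p) →
    (∀ p, Y p = -star (X p)) → ∀ x, Hp n Y x = -star (Hp n X x)
  /-- (E11) `Q′H′ = 1` at the tower sites ((1.91)), at level-periodic families. -/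
  qp_hp : ∀ n, 1 ≤ n → n ≤ m → ∀ (Y : XSpace d n 𝔸),
    (∀ (p : Fin (n + 1) × Site d) (i : Fin d), Y (p.1, p.2 + (P / (L : ℤ) ^ (p.1 : ℕ)) • e i) = Y p) → ∀ (j : ℕ) (hj : j ≤ n) (y : Site d), y ∈ torusLam (d := d) n j →
    QprimeIter (zdBlocking d L) (bgT L U₀) j (Hp n Y) y = Y (⟨j, Nat.lt_succ_of_le hj⟩, y)
  /-- (E12) (1.101) for `G′`: sup and weighted gradient ([4] Thm 3.1 (3.42)₁,₂ in [B8]'s norms), at periodic arguments. -/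
  gp_sup_grad : ∀ n, 1 ≤ n → n ≤ m → ∀ (f : Site d → 𝔸), (∀ (z : Site d) (i : Fin d), f (z + P • e i) = f z) → ∀ (r : ℝ), 0 ≤ r →
    Bd2 L η n (fun _ => (Set.univ : Set (Site d))) f r →
    (∀ x, ‖Gp n f x‖ ≤ BG * r) ∧ ∀ j, j ≤ n → ∀ p ∈ {b : Site d × Fin d | SideTouches (Set.univ : Set (Site d)) b.1 b.2},
      wt L η j * ‖covDerivFwd η U₀ p.2 (Gp n f) p.1‖ ≤ BG * r
  /-- (E13) Dirichlet range of `G′` (vacuous at `Ω₀ = ℤᵈ`, kept verbatim), at periodic arguments. -/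
  gp_dirichlet : ∀ n, 1 ≤ n → n ≤ m → ∀ (f : Site d → 𝔸),
    (∀ (z : Site d) (i : Fin d), f (z + P • e i) = f z) → ∀ (x : Site d), x ∉ (Set.univ : Set (Site d)) → Gp n f x = 0
  /-- (E14) reality of `G′`, at periodic arguments. -/
  gp_real : ∀ n, 1 ≤ n → n ≤ m → ∀ f : Site d → 𝔸, (∀ (z : Site d) (i : Fin d), f (z + P • e i) = f z) →
    (∀ j, j ≤ n → ∀ x ∈ (Set.univ : Set (Site d)), IsSelfAdjoint (f x)) → ∀ x, IsSelfAdjoint (Gp n f x)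
  /-- (E15) (1.98) for `R = 1 − G′Q′ᵀCQ′G′`, at periodic arguments. -/
  r_bound : ∀ n, 1 ≤ n → n ≤ m → ∀ (f : Site d → 𝔸), (∀ (z : Site d) (i : Fin d), f (z + P • e i) = f z) → ∀ (r : ℝ), 0 ≤ r →
    Bd2 L η n (fun _ => (Set.univ : Set (Site d))) f r →
    Bd2 L η n (fun _ => (Set.univ : Set (Site d))) (f - Gp n (QpT n (Cinv n (Qp n (Gp n f))))) (BR * r)
  /-- (E16) reality of `R`, at periodic arguments. -/
  r_real : ∀ n, 1 ≤ n → n ≤ m → ∀ f : Site d → 𝔸, (∀ (z : Site d) (i : Fin d), f (z + P • e i) = f z) →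
    (∀ j, j ≤ n → ∀ x ∈ (Set.univ : Set (Site d)), IsSelfAdjoint (f x)) →
    ∀ j, j ≤ n → ∀ x ∈ (Set.univ : Set (Site d)), IsSelfAdjoint ((f - Gp n (QpT n (Cinv n (Qp n (Gp n f))))) x)
  /-- (U1) [4] Thm 3.1's left-inverse law of `G′` ON BOUNDED PERIODIC FUNCTIONS, top structure. -/
  gp_left_bdd : 1 ≤ m → ∀ x : Site d → 𝔸, (∀ (z : Site d) (i : Fin d), x (z + P • e i) = x z) → (∃ C : ℝ, ∀ y, ‖x y‖ ≤ C) →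
    Gp m (lapU m x + QpT m (Aw m (Qp m x))) = x
  /-- (U2) the law of `C` in the `Q′ᵀ`-form, top structure, at level-periodic families. -/
  cinv_range' : 1 ≤ m → ∀ φ : ℕ → Site d → 𝔸, (∀ j, j ≤ m → ∀ (y : Site d) (i : Fin d), φ j (y + (P / (L : ℤ) ^ j) • e i) = φ j y) →
    QpT m (Cinv m (Qp m (Gp m (Gp m (QpT m φ))))) = QpT m φ
  /-- (U3) `Q′ = 0` off `𝔅_m`, top structure, at periodic arguments. -/
  qp_zero_off : 1 ≤ m → ∀ (f : Site d → 𝔸), (∀ (z : Site d) (i : Fin d), f (z + P • e i) = f z) →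
    ∀ (j : ℕ) (y : Site d), ¬ (j ≤ m ∧ y ∈ torusLam (d := d) m j) → Qp m f j y = 0
  /-- (B) the in-edge b9 in Proposition 3's frame at truncation `m` ([4] Thm 3.3 ⇒ (1.59), p. 86), at `U₀`, for periodic `W`, `A′`. -/
  b9P3 : ∀ α₂ : ℝ, 0 < α₂ → α₂ ≤ cB →
    ∀ W : Site d → Fin d → 𝔸ˣ, (∀ x κ, W x κ ∈ unitaryUnits 𝔸) → (∀ (z : Site d) (i : Fin d), W (z + P • e i) = W z) →
    InAk L m η α₀ (fun _ => (Set.univ : Set (Site d))) U₀ →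
    InAk L m η α₀ (fun _ => (Set.univ : Set (Site d))) (mulCfg W U₀) →
    IsLandau138W L m η (Set.univ : Set (Site d)) (torusLam (d := d) m) U₀ W →
    ∀ A' : Site d → Fin d → 𝔸, (∀ y τ, IsSelfAdjoint (A' y τ)) → (∀ (z : Site d) (i : Fin d), A' (z + P • e i) = A' z) →
    (∀ j, j ≤ m → ∀ (y : Site d) (τ : Fin d), SideTouches (Set.univ : Set (Site d)) y τ →
      W y τ = cfgExp η A' y τ ∧ ‖A' y τ‖ ≤ α₂ * ((L : ℝ) ^ j * η)⁻¹) →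
    (∀ (y : Site d) (τ : Fin d), (∀ j, j ≤ m → ¬ SideTouches (Set.univ : Set (Site d)) y τ) → A' y τ = 0) →
    msup L m η (-(1 : ℝ)) (fun _ (b : Site d × Fin d) => SideTouches (Set.univ : Set (Site d)) b.1 b.2) (fun b => A' b.1 b.2)
        ≤ B₀ * (bondNorm L m η (-(3 : ℝ)) (fun _ => (Set.univ : Set (Site d))) (fun x μ => Jcur η U₀ A' μ x)
          + wsup 1 (fun p : {p : ℕ × (Site d × Fin d) // p.1 ≤ m ∧ p.2 ∈ torusLamb (d := d) m p.1} =>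
              linCovIter L U₀ (iEta η A') p.1.1 p.1.2.1 p.1.2.2)) ∧
      msup L m η (-(2 : ℝ)) (fun _ (t : Fin d × Fin d × Site d) => SideTouches (Set.univ : Set (Site d)) t.2.2 t.2.1)
          (fun t => covDerivFwd η U₀ t.1 (fun z => A' z t.2.1) t.2.2)
        ≤ B₀ * (bondNorm L m η (-(3 : ℝ)) (fun _ => (Set.univ : Set (Site d))) (fun x μ => Jcur η U₀ A' μ x)
          + wsup 1 (fun p : {p : ℕ × (Site d × Fin d) // p.1 ≤ m ∧ p.2 ∈ torusLamb (d := d) m p.1} =>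
              linCovIter L U₀ (iEta η A') p.1.1 p.1.2.1 p.1.2.2)) ∧
      bondNorm L m η (-(3 : ℝ)) (fun _ => (Set.univ : Set (Site d))) (fun x μ => pdiv η U₀ (plaqCovDeriv η U₀ A') μ x)
        ≤ B₀ * (bondNorm L m η (-(3 : ℝ)) (fun _ => (Set.univ : Set (Site d))) (fun x μ => Jcur η U₀ A' μ x)
          + wsup 1 (fun p : {p : ℕ × (Site d × Fin d) // p.1 ≤ m ∧ p.2 ∈ torusLamb (d := d) m p.1} =>
              linCovIter L U₀ (iEta η A') p.1.1 p.1.2.1 p.1.2.2)) ∧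
      bondNorm L m η (-(3 : ℝ)) (fun _ => (Set.univ : Set (Site d))) (fun x μ => covLap η U₀ (fun z => A' z μ) x)
        ≤ B₀ * (bondNorm L m η (-(3 : ℝ)) (fun _ => (Set.univ : Set (Site d))) (fun x μ => Jcur η U₀ A' μ x)
          + wsup 1 (fun p : {p : ℕ × (Site d × Fin d) // p.1 ≤ m ∧ p.2 ∈ torusLamb (d := d) m p.1} =>
              linCovIter L U₀ (iEta η A') p.1.1 p.1.2.1 p.1.2.2)) ∧
      msup L m η (-(2 + β)) (fun _ (q : Fin d × Fin d × (Site d × Site d)) =>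
            q.2.2 ∈ AdmPair η len ∧ q.2.2.1 ∈ (Set.univ : Set (Site d)))
          (fun q => hquot η β len U₀ (covDerivFwd η U₀ q.1 (fun z => A' z q.2.1)) q.2.2)
        ≤ B₀β * (bondNorm L m η (-(3 : ℝ)) (fun _ => (Set.univ : Set (Site d))) (fun x μ => Jcur η U₀ A' μ x)
          + wsup 1 (fun p : {p : ℕ × (Site d × Fin d) // p.1 ≤ m ∧ p.2 ∈ torusLamb (d := d) m p.1} =>
              linCovIter L U₀ (iEta η A') p.1.1 p.1.2.1 p.1.2.2))


/-- The sup line of (E12) alone, at a periodic argument. [cite: Balaban1985RegularSpaces, (1.101) p.93; Balaban1985BackgroundPropagators, Thm 3.1 (3.42) p.397] -/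
theorem LettersAtPer.gp_sup {L : ℕ} {BG BR B₀'H B₂' B₀ B₀β cB β : ℝ} {len : Site d → ℝ} {η : ℝ} {m : ℕ} {α₀ : ℝ} {P : ℤ}
    {U₀ : Site d → Fin d → 𝔸ˣ} (lt : LettersAtPer (𝔸 := 𝔸) L BG BR B₀'H B₂' B₀ B₀β cB β len η m α₀ P U₀) {n : ℕ} (hn : 1 ≤ n) (hnm : n ≤ m)
    {f : Site d → 𝔸} (hf : (∀ (z : Site d) (i : Fin d), f (z + P • e i) = f z)) {r : ℝ} (hr : 0 ≤ r)
    (hb : Bd2 L η n (fun _ => (Set.univ : Set (Site d))) f r) : ∀ x, ‖lt.Gp n f x‖ ≤ BG * r :=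
  (lt.gp_sup_grad n hn hnm f hf r hr hb).1

/-- **v2 + (P) ⇒ v3**: a `LettersAt` bundle (laws at ALL arguments) whose letters map periodic arguments to periodic values IS a `LettersAtPer` bundle
(same letters) — the v3 bundle asks LESS of the letters.  (Route K's `ℤᵈ` letters at a periodic background, if shift-covariant, serve v3.)
[cite: Balaban1985RegularSpaces, Thm 2 p.83, p.77 («Ω_j = T_η»); Balaban1985BackgroundPropagators, Thms 3.1–3.3 pp.397–399] -/
def LettersAtPer.ofLettersAt {L : ℕ} {BG BR B₀'H B₂' B₀ B₀β cB β : ℝ} {len : Site d → ℝ} {η : ℝ} {m : ℕ} {α₀ : ℝ} {P : ℤ}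
    {U₀ : Site d → Fin d → 𝔸ˣ} (lt : B8Thm2TorusLetters.LettersAt (𝔸 := 𝔸) L BG BR B₀'H B₂' B₀ B₀β cB β len η m α₀ U₀)
    (h1 : ∀ n, 1 ≤ n → n ≤ m → ∀ f : Site d → 𝔸, (∀ (z : Site d) (i : Fin d), f (z + P • e i) = f z) →
      (∀ (z : Site d) (i : Fin d), (lt.Gp n f) (z + P • e i) = (lt.Gp n f) z))
    (h2 : ∀ n, 1 ≤ n → n ≤ m → ∀ f : Site d → 𝔸, (∀ (z : Site d) (i : Fin d), f (z + P • e i) = f z) →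
      (∀ j, j ≤ n → ∀ (y : Site d) (i : Fin d), (lt.Qp n f) j (y + (P / (L : ℤ) ^ j) • e i) = (lt.Qp n f) j y))
    (h3 : ∀ n, 1 ≤ n → n ≤ m → ∀ μ : ℕ → Site d → 𝔸, (∀ j, j ≤ n → ∀ (y : Site d) (i : Fin d), μ j (y + (P / (L : ℤ) ^ j) • e i) = μ j y) →
      (∀ (z : Site d) (i : Fin d), (lt.QpT n μ) (z + P • e i) = (lt.QpT n μ) z))
    (h4 : ∀ n, 1 ≤ n → n ≤ m → ∀ μ : ℕ → Site d → 𝔸, (∀ j, j ≤ n → ∀ (y : Site d) (i : Fin d), μ j (y + (P / (L : ℤ) ^ j) • e i) = μ j y) →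
      (∀ j, j ≤ n → ∀ (y : Site d) (i : Fin d), (lt.Aw n μ) j (y + (P / (L : ℤ) ^ j) • e i) = (lt.Aw n μ) j y))
    (h5 : ∀ n, 1 ≤ n → n ≤ m → ∀ μ : ℕ → Site d → 𝔸, (∀ j, j ≤ n → ∀ (y : Site d) (i : Fin d), μ j (y + (P / (L : ℤ) ^ j) • e i) = μ j y) →
      (∀ j, j ≤ n → ∀ (y : Site d) (i : Fin d), (lt.Cinv n μ) j (y + (P / (L : ℤ) ^ j) • e i) = (lt.Cinv n μ) j y))
    (h6 : ∀ n, 1 ≤ n → n ≤ m → ∀ X : XSpace d n 𝔸, (∀ (p : Fin (n + 1) × Site d) (i : Fin d), X (p.1, p.2 + (P / (L : ℤ) ^ (p.1 : ℕ)) • e i) = X p) →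
      (∀ (z : Site d) (i : Fin d), (lt.Hp n X) (z + P • e i) = (lt.Hp n X) z)) :
    LettersAtPer (𝔸 := 𝔸) L BG BR B₀'H B₂' B₀ B₀β cB β len η m α₀ P U₀ where
  Gp := lt.Gp
  lapU := lt.lapU
  Qp := lt.Qp
  QpT := lt.QpT
  Aw := lt.Aw
  Cinv := lt.Cinv
  Hp := lt.Hp
  gp_per := h1
  qp_per := h2
  qpT_per := h3
  aw_per := h4
  cinv_per := h5
  hp_per := h6
  gp_right := fun n hn hnm x _ y hy => lt.gp_right n hn hnm x y hy
  cinv_range := fun n hn hnm f _ => lt.cinv_range n hn hnm f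
  lapU_reads := fun n hn hnm f _ x hx => lt.lapU_reads n hn hnm f x hx
  qpT_reads := fun n hn hnm μ _ x hx => lt.qpT_reads n hn hnm μ x hx
  qp_reads := fun n hn hnm f _ j hj y hy => lt.qp_reads n hn hnm f j hj y hy
  hp_sup := fun n hn hnm X _ x => lt.hp_sup n hn hnm X x
  hp_grad := fun n hn hnm j hj X _ p hp => lt.hp_grad n hn hnm j hj X p hp
  hp_lap := fun n hn hnm X _ => lt.hp_lap n hn hnm X
  hp_dirichlet := fun n hn hnm X _ x hx => lt.hp_dirichlet n hn hnm X x hx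
  hp_real := fun n hn hnm X Y _ _ h x => lt.hp_real n hn hnm X Y h x
  qp_hp := fun n hn hnm Y _ j hj y hy => lt.qp_hp n hn hnm Y j hj y hy
  gp_sup_grad := fun n hn hnm f _ r hr hb => lt.gp_sup_grad n hn hnm f r hr hb
  gp_dirichlet := fun n hn hnm f _ x hx => lt.gp_dirichlet n hn hnm f x hx
  gp_real := fun n hn hnm f _ h x => lt.gp_real n hn hnm f h x
  r_bound := fun n hn hnm f _ r hr hb => lt.r_bound n hn hnm f r hr hb
  r_real := fun n hn hnm f _ h j hj x hx => lt.r_real n hn hnm f h j hj x hx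
  gp_left_bdd := fun hm x _ hC => lt.gp_left_bdd hm x hC
  cinv_range' := fun hm φ _ => lt.cinv_range' hm φ
  qp_zero_off := fun hm f _ j y h => lt.qp_zero_off hm f j y h
  b9P3 := fun α₂ h0 hc W hW _ h33 h34 hLan A' hsa _ hexp hoff => lt.b9P3 α₂ h0 hc W hW h33 h34 hLan A' hsa hexp hoff

end Bundle

/-! ## §2 The binders: all truncations ∕ regularities ∕ periodic backgrounds of the class, and the `τ`-laws -/

section Binders

variable {𝔸 : Type*} [CStarAlgebra 𝔸]

/-- **THE v3 LETTERS AT ALL TORUS MEMBERS `≤ k`, `P`-PERIODIC `G`-VALUED BACKGROUNDS, LAWS AT `P`-PERIODIC ARGUMENTS**: for every truncation `m ≤ k`,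
every `0 < α₀ ≤ c_L` and every background `U₀` that is `G`-valued, `P`-periodic and satisfies (1.33) at `m` levels on the whole lattice, the bundle
`LettersAtPer … η m α₀ P U₀`.  The v2 binder `B8Thm2TorusLetters.LettersAllP` asks the same backgrounds but laws at all arguments.  A `Type` of
hypotheses, not a `Prop` fact. [cite: Balaban1985RegularSpaces, Thm 2 p.83, Thm 4 p.88, p.77 («Ω_j = T_η»), (1.33) p.82; Balaban1985BackgroundPropagators, Thms 3.1–3.3 pp.397–399] -/
def LettersAllPer (L : ℕ) (BG BR B₀'H B₂' B₀ B₀β cB β : ℝ) (len : Site d → ℝ) (cL : ℝ) (η : ℝ) (k : ℕ) (P : ℤ) (G : Subgroup 𝔸ˣ) :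
    Type _ :=
  ∀ m, m ≤ k → ∀ ⦃α₀ : ℝ⦄, 0 < α₀ → α₀ ≤ cL → ∀ U₀ : Site d → Fin d → 𝔸ˣ, (∀ x κ, U₀ x κ ∈ G) →
    (∀ (x : Site d) (i : Fin d), U₀ (x + P • e i) = U₀ x) →
    InAk L m η α₀ (fun _ => (Set.univ : Set (Site d))) U₀ → LettersAtPer (𝔸 := 𝔸) L BG BR B₀'H B₂' B₀ B₀β cB β len η m α₀ P U₀

/-- A smaller regularity threshold `c_L′ ≤ c_L` asks fewer backgrounds. [cite: Balaban1985RegularSpaces, Thm 2 p.83] -/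
def lettersAllPer_anti {L : ℕ} {BG BR B₀'H B₂' B₀ B₀β cB β : ℝ} {len : Site d → ℝ} {cL cL' η : ℝ} {k : ℕ} {P : ℤ} {G : Subgroup 𝔸ˣ}
    (h : cL' ≤ cL) (ℓ : LettersAllPer (𝔸 := 𝔸) L BG BR B₀'H B₂' B₀ B₀β cB β len cL η k P G) :
    LettersAllPer (𝔸 := 𝔸) L BG BR B₀'H B₂' B₀ B₀β cB β len cL' η k P G :=
  fun m hm _ h0 hc U₀ hU₀ hP hA => ℓ m hm h0 (hc.trans h) U₀ hU₀ hP hA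

/-- **J-SU ADD-ON, v3: `τ`-COMPATIBILITY OF `H′`, `G′` AND `R = 1 − G′Q′ᵀCQ′G′` AT PERIODIC ARGUMENTS** — `B8Thm2TorusLetters.LettersTau` VERBATIM with the
arguments restricted to `P`-periodic ones (print p. 76: for `G = SU(N)` the configurations are `𝔰𝔲(N)`-valued; [4]'s linear operators on `T_η` map
trace-free periodic configurations to trace-free ones).  A law about the letters, asserted for nothing.
[cite: Balaban1985RegularSpaces, p.76, (1.17) p.78, (1.91)–(1.92) p.91, (1.95)–(1.98) p.92] -/
structure LettersPerTau (τ : 𝔸 →L[ℂ] ℂ) {L : ℕ} {BG BR B₀'H B₂' B₀ B₀β cB β : ℝ} {len : Site d → ℝ} {η : ℝ} {m : ℕ} {α₀ : ℝ} {P : ℤ}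
    {U₀ : Site d → Fin d → 𝔸ˣ} (lt : LettersAtPer (𝔸 := 𝔸) L BG BR B₀'H B₂' B₀ B₀β cB β len η m α₀ P U₀) : Prop where
  /-- `H′` maps `τ`-free periodic families to `τ`-free configurations. -/
  hp_tau : ∀ n, 1 ≤ n → n ≤ m → ∀ X : XSpace d n 𝔸,
    (∀ (p : Fin (n + 1) × Site d) (i : Fin d), X (p.1, p.2 + (P / (L : ℤ) ^ (p.1 : ℕ)) • e i) = X p) → (∀ p, τ (X p) = 0) → ∀ x, τ (lt.Hp n X x) = 0
  /-- `G′` maps `τ`-free periodic configurations to `τ`-free configurations. -/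
  gp_tau : ∀ n, 1 ≤ n → n ≤ m → ∀ f : Site d → 𝔸, (∀ (z : Site d) (i : Fin d), f (z + P • e i) = f z) →
    (∀ j, j ≤ n → ∀ x ∈ (Set.univ : Set (Site d)), τ (f x) = 0) → ∀ x, τ (lt.Gp n f x) = 0
  /-- `R = 1 − G′Q′ᵀCQ′G′` maps `τ`-free periodic configurations to `τ`-free configurations. -/
  r_tau : ∀ n, 1 ≤ n → n ≤ m → ∀ f : Site d → 𝔸, (∀ (z : Site d) (i : Fin d), f (z + P • e i) = f z) →
    (∀ j, j ≤ n → ∀ x ∈ (Set.univ : Set (Site d)), τ (f x) = 0) →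
      ∀ j, j ≤ n → ∀ x ∈ (Set.univ : Set (Site d)), τ ((f - lt.Gp n (lt.QpT n (lt.Cinv n (lt.Qp n (lt.Gp n f))))) x) = 0

/-- **The `τ`-add-on at all periodic torus members, v3.** [cite: Balaban1985RegularSpaces, p.76, (1.91)–(1.98) pp.91–92] -/
def LettersAllPerTau (τ : 𝔸 →L[ℂ] ℂ) {L : ℕ} {BG BR B₀'H B₂' B₀ B₀β cB β : ℝ} {len : Site d → ℝ} {cL η : ℝ} {k : ℕ} {P : ℤ}
    {G : Subgroup 𝔸ˣ} (ℓ : LettersAllPer (𝔸 := 𝔸) L BG BR B₀'H B₂' B₀ B₀β cB β len cL η k P G) : Prop :=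
  ∀ (m : ℕ) (hm : m ≤ k) (α₀ : ℝ) (h0 : 0 < α₀) (hc : α₀ ≤ cL) (U₀ : Site d → Fin d → 𝔸ˣ) (hU₀ : ∀ x κ, U₀ x κ ∈ G)
    (hP : ∀ (x : Site d) (i : Fin d), U₀ (x + P • e i) = U₀ x) (hA : InAk L m η α₀ (fun _ => (Set.univ : Set (Site d))) U₀),
    LettersPerTau (𝔸 := 𝔸) τ (ℓ m hm h0 hc U₀ hU₀ hP hA)

/-- The `τ`-laws pass to the smaller threshold. [cite: Balaban1985RegularSpaces, p.76] -/
theorem lettersAllPerTau_anti (τ : 𝔸 →L[ℂ] ℂ) {L : ℕ} {BG BR B₀'H B₂' B₀ B₀β cB β : ℝ} {len : Site d → ℝ} {cL cL' η : ℝ} {k : ℕ} {P : ℤ}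
    {G : Subgroup 𝔸ˣ} (h : cL' ≤ cL) {ℓ : LettersAllPer (𝔸 := 𝔸) L BG BR B₀'H B₂' B₀ B₀β cB β len cL η k P G} (hτ : LettersAllPerTau τ ℓ) :
    LettersAllPerTau τ (lettersAllPer_anti h ℓ) :=
  fun m hm α₀ h0 hc U₀ hU₀ hP hA => hτ m hm α₀ h0 (hc.trans h) U₀ hU₀ hP hA

/-- **v2 + (P) ⇒ v3 for the `τ`-laws.** [cite: Balaban1985RegularSpaces, p.76] -/
theorem LettersPerTau.ofLettersTau (τ : 𝔸 →L[ℂ] ℂ) {L : ℕ} {BG BR B₀'H B₂' B₀ B₀β cB β : ℝ} {len : Site d → ℝ} {η : ℝ} {m : ℕ} {α₀ : ℝ}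
    {P : ℤ} {U₀ : Site d → Fin d → 𝔸ˣ} {lt : B8Thm2TorusLetters.LettersAt (𝔸 := 𝔸) L BG BR B₀'H B₂' B₀ B₀β cB β len η m α₀ U₀}
    (hτ : B8Thm2TorusLetters.LettersTau (𝔸 := 𝔸) τ lt) {h1 h2 h3 h4 h5 h6}
    : LettersPerTau (𝔸 := 𝔸) τ (LettersAtPer.ofLettersAt (P := P) lt h1 h2 h3 h4 h5 h6) where
  hp_tau := fun n hn hnm X _ hX x => hτ.hp_tau n hn hnm X hX x
  gp_tau := fun n hn hnm f _ hf x => hτ.gp_tau n hn hnm f hf x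
  r_tau := fun n hn hnm f _ hf j hj x hx => hτ.r_tau n hn hnm f hf j hj x hx

end Binders

end Literature.MathematicalPhysics.QuantumFieldTheory.Balaban1983to89.B8Thm2TorusLettersPer

end
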